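import Literature.RingTheory.CompleteIntersection.MonogenicDualizingForm
import Literature.NumberTheory.EllipticCurves.ZpExtensionScalarTwist
import Literature.NumberTheory.EllipticCurves.IwasawaAlgebraSpecializationCountProofs
import Mathlib.NumberTheory.Padics.RingHoms
import HarnessLib

/-!
# Duality for Howard's Eisenstein quotients: the tail form of `S_m = Λ/(T^m + p)` over `ℤ_p` and the
# Pontryagin self-duality `A_{m,k} ≅ Hom(A_{m,k}, ℤ/p^k)` of `A_{m,k} = Λ/(T^m + p, p^k)`

Topic `NumberTheory/EllipticCurves` (sequel to `IwasawaAlgebraEisensteinQuotientDVRProofs`,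
`IwasawaAlgebraSpecializationCountProofs`, `ZpExtensionScalarTwist`; pure commutative algebra).

Howard 2004, §2.1 (arXiv §3.1, before Lemma 2.1.1): for a height-one prime `𝔭 ≠ pΛ` with `S_𝔭` the integral
closure of `Λ/𝔭`, "the trace from `Φ_𝔭` to `ℚ_p` defines a surjective map `𝒟_𝔭 → ℚ_p/ℤ_p` (through the inverse
different) whose kernel contains no `S_𝔭`-submodules. This map induces an isomorphism of `S_𝔭`-modules
`Hom_{S_𝔭}(N, 𝒟_𝔭(1)) ≅ Hom_{ℤ_p}(N, μ_{p^∞})`" — the bridge between `S_𝔭`-valued dualities (H.4, the local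
pairing `⟨ , ⟩_v : H¹(K_v,T) × H¹(K_v̄,T) → R`, the structure `H¹_F(K,A) ≅ 𝒟 ⊕ M ⊕ M`) and Tate's `ℤ_p`-valued
ones. At the Eisenstein prime `𝔮 = 𝔮_m = (T^m + p)` of the proof of Thm. 2.2.10, `Λ/𝔮 = ℤ_p[π]`, `π^m = -p`, is
already a DVR (tree `isDiscreteValuationRing_quotient_X_pow_add_C`), so `S_𝔮 = Λ/𝔮 =: S_m`, and the bridge is
the **Frobenius (tail) form** of the monogenic `ℤ_p`-algebra `S_m` (tree
`Literature.RingTheory.CompleteIntersection.tailForm`: the coefficient of `π^{m-1}` — the inverse-different-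
twisted trace of Howard, computed without denominators by Euler's lemma).

WHAT (all `m ≥ 1`):
* §1 `specAlgEquiv`, **`specPowerBasis p hm : PowerBasis ℤ_[p] S_m`** (`1, π, …, π^{m-1}`, via Mathlib's
  Weierstrass division `Polynomial.IsDistinguishedAt.algEquivQuotient`), `specPowerBasis_dim = m`,
  `specPowerBasis_gen = π = [T]`; hence (tree file `MonogenicDualizingForm`, nothing to re-prove) the tail form
  `λ_S = tailForm (specPowerBasis p hm) : S_m →ₗ[ℤ_p] ℤ_p` is PERFECT (`tailPairingEquiv`), with dual basis and
  Frobenius reciprocity `Hom_{S_m}(N, S_m) ≅ Hom_{ℤ_p}(N, ℤ_p)` (`tailFormCompEquiv`); `tailForm_mk_X_pow`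
  (`λ_S(π^i) = [i = m-1]`, `i < m`).
* §2 **`EisensteinCoeff.tailFormZMod p hm k : A_{m,k} →ₗ[ℤ] ZMod (p^k)`**, `λ_k([x]) = λ_S([x]) mod p^k`
  (`EisensteinCoeff.tailFormZMod_mk`), and the bi-additive, symmetric, `A_{m,k}`-balanced pairing
  `EisensteinCoeff.tailPairingZMod p hm k : A_{m,k} →+ (A_{m,k} →+ ZMod (p^k))`, `(c', c) ↦ λ_k(c' c)`.
* §3 **Pontryagin self-duality of `A_{m,k}`**: `EisensteinCoeff.tailPairingZMod_injective` (dual-basis expansion in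
  `S_m` + `ker (ℤ_p → ℤ/p^k) = (p^k)`), `natCard_addMonoidHom_zmod_le` (`#Hom(A_{m,k}, ℤ/p^k) ≤ p^{km} = #A_{m,k}`,
  evaluation at the `ℤ`-generators `[T^i]`), **`EisensteinCoeff.tailPairingZMod_bijective`** and
  `EisensteinCoeff.tailPairingZModEquiv : A_{m,k} ≃+ (A_{m,k} →+ ZMod (p^k))`: every character of the additive
  group `A_{m,k}` is `λ_k(c' · )` for a unique `c'` — `Hom_ℤ(A_{m,k}, ℚ/ℤ) ≅ A_{m,k}` as `A_{m,k}`-modules.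

WHY (cell `pub/bsd-print-x9`, shared μ-residual of rows 9/10, port of Howard's Thm. 2.2.10 argument at
`𝔮 = T^m + p`, REF-131: Howard's Thm. 1.6.1 cite-only over the DVR `S_m` with H.0–H.5 to DISCHARGE for
`T_𝔮 = T_pE ⊗ S_m(ψ)`): H.4 asks for a perfect `S_m`-bilinear pairing `T_𝔮 × T_𝔮 → S_m(1)` whose induced LOCAL
pairings `H¹(K_v, T_𝔮) × H¹(K_v̄, T_𝔮) → S_m` make `F_𝔮` self-orthogonal; identifying these `S_m`-valued pairings
with the tree's `ℤ`-valued Tate duality (`tateDual`, `tateDualPairingLocal`) on the finite carriers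
`E[p^k] ⊗ A_{m,k}(ψ)` (`ZpExtension.eisensteinTwist`) is exactly §1 (reciprocity) and §3 (the Cartier dual of
`M ⊗ A_{m,k}(ψ)` is `M^∨(1) ⊗ A_{m,k}(ψ⁻¹)` BECAUSE `A_{m,k}^∨ ≅ A_{m,k}`). Pure algebra; nothing about Galois
cohomology is asserted here. BSD is not proved by any of this.

References: [Howard2004HeegnerKolyvagin] B. Howard, Compositio Math. 140 (2004), §2.1 (the map
`𝒟_𝔭 → ℚ_p/ℤ_p` and `Hom_{S_𝔭}(N, 𝒟_𝔭(1)) ≅ Hom_{ℤ_p}(N, μ_{p^∞})`), Lemma 2.1.1, hypothesis H.4 of §1.3, proof of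
Thm. 2.2.10 (`𝔮 = T^m + p`); [DeSmitRubinSchoof1997] Prop. 2.1 (Tate); [Washington1997] Prop. 7.2, §13.2.
-/

noncomputable section

open scoped Classical
open Polynomial

universe v

namespace Literature.NumberTheory.EllipticCurves.IwasawaAlgebra

open Literature.RingTheory.CompleteIntersection

variable (p : ℕ) [hp : Fact p.Prime]

/-! ## §1 The power basis `1, π, …, π^{m-1}` of `S_m = Λ/(T^m + p)` over `ℤ_p` -/

/-- `q_m = X^m + p ∈ ℤ_p[X]` is monic for `m ≥ 1`. [cite: Washington1997, §7.1 (Prop. 7.2)] -/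
theorem monic_X_pow_add_C_padicInt {m : ℕ} (hm : 1 ≤ m) :
    (Polynomial.X ^ m + Polynomial.C (p : ℤ_[p]) : ℤ_[p][X]).Monic :=
  Polynomial.monic_X_pow_add_C _ (by omega)

/-- **`ℤ_p[X]/(X^m + p) ≃ₐ[ℤ_p] S_m = Λ/(T^m + p)`** (Weierstrass division by the distinguished polynomial
`q_m`, Mathlib `Polynomial.IsDistinguishedAt.algEquivQuotient`, followed by the identification of the power
series of `q_m`). [cite: Washington1997, §7.1 (Prop. 7.2)] [cite: Howard2004HeegnerKolyvagin, §2.2 (S_𝔮 = Λ/𝔮) and proof of Thm. 2.2.10 (𝔮 = T^m + p)] -/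
def specAlgEquiv {m : ℕ} (hm : 1 ≤ m) :
    AdjoinRoot (Polynomial.X ^ m + Polynomial.C (p : ℤ_[p]) : ℤ_[p][X]) ≃ₐ[ℤ_[p]]
      IwasawaAlgebra p ⧸ Ideal.span {(PowerSeries.X ^ m + PowerSeries.C (p : ℤ_[p]) : IwasawaAlgebra p)} :=
  (isDistinguishedAt_X_pow_add_C p hm).algEquivQuotient.trans
    (Ideal.quotientEquivAlgOfEq ℤ_[p] (by rw [coe_X_pow_add_C]))

/-- The isomorphism sends the class of a polynomial to the class of its power series.
[cite: Washington1997, §7.1 (Prop. 7.2)] -/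
theorem specAlgEquiv_mk {m : ℕ} (hm : 1 ≤ m) (g : ℤ_[p][X]) :
    specAlgEquiv p hm (AdjoinRoot.mk _ g) = Ideal.Quotient.mk _ (g : IwasawaAlgebra p) :=
  rfl

/-- **The power basis `1, π, …, π^{m-1}` of `S_m = Λ/(T^m + p)` over `ℤ_p`** (`π = [T]`), transported from
`AdjoinRoot.powerBasis'` along `specAlgEquiv`. [cite: Washington1997, §7.1 (Prop. 7.2) and §13.2]
[cite: Howard2004HeegnerKolyvagin, §2.2 (S_𝔮) and proof of Thm. 2.2.10 (𝔮 = T^m + p)] -/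
def specPowerBasis {m : ℕ} (hm : 1 ≤ m) :
    PowerBasis ℤ_[p]
      (IwasawaAlgebra p ⧸ Ideal.span {(PowerSeries.X ^ m + PowerSeries.C (p : ℤ_[p]) : IwasawaAlgebra p)}) :=
  (AdjoinRoot.powerBasis' (monic_X_pow_add_C_padicInt p hm)).map (specAlgEquiv p hm)

/-- The power basis has `m` elements. [cite: Washington1997, §7.1 (Prop. 7.2)] -/
@[simp]
theorem specPowerBasis_dim {m : ℕ} (hm : 1 ≤ m) : (specPowerBasis p hm).dim = m := by
  rw [specPowerBasis, PowerBasis.map_dim, AdjoinRoot.powerBasis'_dim, Polynomial.natDegree_X_pow_add_C]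

/-- Its generator is `π = [T]`. [cite: Washington1997, §7.1 (Prop. 7.2)] -/
@[simp]
theorem specPowerBasis_gen {m : ℕ} (hm : 1 ≤ m) :
    (specPowerBasis p hm).gen = Ideal.Quotient.mk _ (PowerSeries.X : IwasawaAlgebra p) := by
  rw [specPowerBasis, PowerBasis.map_gen, AdjoinRoot.powerBasis'_gen, AdjoinRoot.root, specAlgEquiv_mk,
    Polynomial.coe_X]

/-- **Values of the tail form `λ_S` on the power basis**: `λ_S(π^i) = 1` if `i = m - 1`, `0` if `i < m - 1`.
[cite: DeSmitRubinSchoof1997, Prop. 2.1 (case n = 1)] [cite: Howard2004HeegnerKolyvagin, §2.1 (the map 𝒟_𝔭 → ℚ_p/ℤ_p)] -/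
theorem tailForm_mk_X_pow {m : ℕ} (hm : 1 ≤ m) {i : ℕ} (hi : i < m) :
    tailForm (specPowerBasis p hm) (Ideal.Quotient.mk _ ((PowerSeries.X : IwasawaAlgebra p) ^ i)) =
      if i = m - 1 then 1 else 0 := by
  have h := tailForm_gen_pow (specPowerBasis p hm) (k := i) (by rwa [specPowerBasis_dim])
  rwa [specPowerBasis_gen, ← map_pow, specPowerBasis_dim] at h

/-- **Non-degeneracy of `λ_S` on `S_m`** (restated from `MonogenicDualizingForm` for the tree's spelling):
`λ_S(y z) = 0` for all `z` forces `y = 0`. [cite: DeSmitRubinSchoof1997, Prop. 2.1 (case n = 1)]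
[cite: Howard2004HeegnerKolyvagin, §2.1 («whose kernel contains no S_𝔭-submodules»)] -/
theorem eq_zero_of_forall_tailForm_spec_mul_eq_zero {m : ℕ} (hm : 1 ≤ m)
    {y : IwasawaAlgebra p ⧸ Ideal.span {(PowerSeries.X ^ m + PowerSeries.C (p : ℤ_[p]) : IwasawaAlgebra p)}}
    (hy : ∀ z, tailForm (specPowerBasis p hm) (y * z) = 0) : y = 0 :=
  eq_zero_of_forall_tailForm_mul_eq_zero _ hy

/-! ## §2 The tail form and pairing of `A_{m,k} = Λ/(T^m + p, p^k)` with values in `ℤ/p^k` -/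

/-- The `ℤ`-linear functional `Λ → ℤ/p^k`, `x ↦ λ_S([x]) mod p^k` (auxiliary: it descends to `A_{m,k}`).
[cite: Howard2004HeegnerKolyvagin, §2.1 (the map 𝒟_𝔭 → ℚ_p/ℤ_p) and §2.2] -/
def tailFormModPow {m : ℕ} (hm : 1 ≤ m) (k : ℕ) : IwasawaAlgebra p →ₗ[ℤ] ZMod (p ^ k) :=
  (PadicInt.toZModPow k : ℤ_[p] →+* ZMod (p ^ k)).toAddMonoidHom.toIntLinearMap ∘ₗ
    ((tailForm (specPowerBasis p hm)).restrictScalars ℤ ∘ₗ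
      (Ideal.Quotient.mk (Ideal.span {(PowerSeries.X ^ m + PowerSeries.C (p : ℤ_[p]) :
        IwasawaAlgebra p)})).toAddMonoidHom.toIntLinearMap)

/-- Unfolding: `tailFormModPow x = (λ_S [x]) mod p^k`. [cite: Howard2004HeegnerKolyvagin, §2.1 and §2.2] -/
@[simp]
theorem tailFormModPow_apply {m : ℕ} (hm : 1 ≤ m) (k : ℕ) (x : IwasawaAlgebra p) :
    tailFormModPow p hm k x = PadicInt.toZModPow k (tailForm (specPowerBasis p hm) (Ideal.Quotient.mk _ x)) :=
  rfl

/-- `p^k` goes to `0` in `ℤ/p^k` under `ℤ_p → ℤ/p^k`. [cite: Washington1997, §13.2] -/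
theorem toZModPow_natCast_pow_mul (k : ℕ) (u : ℤ_[p]) :
    PadicInt.toZModPow k (((p : ℤ_[p]) ^ k) * u) = 0 := by
  rw [map_mul, map_pow, map_natCast, ZMod.natCast_self_pow]
  exact zero_mul _
  where
  /-- `(p : ZMod (p^k))^k = 0`. [cite: Washington1997, §13.2] -/
  ZMod.natCast_self_pow : ((p : ZMod (p ^ k)) ^ k) = 0 := by
    rw [← Nat.cast_pow, ZMod.natCast_self]

/-- The ideal `(T^m + p, p^k)` is killed by `tailFormModPow`. [cite: Howard2004HeegnerKolyvagin, §2.2 (A_𝔮 and T_𝔮/p^k)] -/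
theorem le_ker_tailFormModPow {m : ℕ} (hm : 1 ≤ m) (k : ℕ) :
    (Ideal.span {(PowerSeries.X ^ m + PowerSeries.C (p : ℤ_[p]) : IwasawaAlgebra p)} ⊔
        Ideal.span {PowerSeries.C ((p : ℤ_[p]) ^ k)}).restrictScalars ℤ ≤
      LinearMap.ker (tailFormModPow p hm k) := by
  intro x hx
  rw [Submodule.restrictScalars_mem] at hx
  rw [LinearMap.mem_ker, tailFormModPow_apply]
  obtain ⟨a, ha, b, hb, rfl⟩ := Submodule.mem_sup.mp hx
  obtain ⟨g, rfl⟩ := Ideal.mem_span_singleton'.mp hb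
  have ha0 : (Ideal.Quotient.mk (Ideal.span {(PowerSeries.X ^ m + PowerSeries.C (p : ℤ_[p]) :
      IwasawaAlgebra p)}) a) = 0 := Ideal.Quotient.eq_zero_iff_mem.mpr ha
  have hC : (Ideal.Quotient.mk (Ideal.span {(PowerSeries.X ^ m + PowerSeries.C (p : ℤ_[p]) :
      IwasawaAlgebra p)}) (g * PowerSeries.C ((p : ℤ_[p]) ^ k))) =
      ((p : ℤ_[p]) ^ k) • Ideal.Quotient.mk _ g := by
    rw [mul_comm, ← PowerSeries.smul_eq_C_mul]
    rfl
  rw [map_add, ha0, zero_add, hC, LinearMap.map_smul, smul_eq_mul]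
  exact toZModPow_natCast_pow_mul p k _

/-- **The tail form of `A_{m,k}`**: the additive (`ℤ`-linear) functional `λ_k : A_{m,k} → ℤ/p^k`,
`λ_k([x]) = λ_S([x]) mod p^k` — the finite-level shadow of Howard's map `𝒟_𝔮 → ℚ_p/ℤ_p` at `𝔮 = (T^m + p)`
(restricted to `p^{-k}S_𝔮/S_𝔮 ≅ A_{m,k}`). [cite: Howard2004HeegnerKolyvagin, §2.1 (the map 𝒟_𝔭 → ℚ_p/ℤ_p) and §2.2 (proof of Thm. 2.2.10, 𝔮 = T^m + p)] -/
def EisensteinCoeff.tailFormZMod {m : ℕ} (hm : 1 ≤ m) (k : ℕ) : EisensteinCoeff p m k →ₗ[ℤ] ZMod (p ^ k) :=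
  ((Submodule.restrictScalars ℤ (Ideal.span {(PowerSeries.X ^ m + PowerSeries.C (p : ℤ_[p]) :
      IwasawaAlgebra p)} ⊔ Ideal.span {PowerSeries.C ((p : ℤ_[p]) ^ k)})).liftQ (tailFormModPow p hm k)
      (le_ker_tailFormModPow p hm k)) ∘ₗ
    (Submodule.Quotient.restrictScalarsEquiv ℤ (Ideal.span {(PowerSeries.X ^ m + PowerSeries.C (p : ℤ_[p]) :
      IwasawaAlgebra p)} ⊔ Ideal.span {PowerSeries.C ((p : ℤ_[p]) ^ k)})).symm.toLinearMap

/-- **Unfolding**: `λ_k([x]) = λ_S([x]) mod p^k`. [cite: Howard2004HeegnerKolyvagin, §2.1 and §2.2] -/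
@[simp]
theorem EisensteinCoeff.tailFormZMod_mk {m : ℕ} (hm : 1 ≤ m) (k : ℕ) (x : IwasawaAlgebra p) :
    EisensteinCoeff.tailFormZMod p hm k (Ideal.Quotient.mk _ x) =
      PadicInt.toZModPow k (tailForm (specPowerBasis p hm) (Ideal.Quotient.mk _ x)) := by
  rw [EisensteinCoeff.tailFormZMod, LinearMap.comp_apply]
  change ((Submodule.restrictScalars ℤ _).liftQ (tailFormModPow p hm k) _)
    ((Submodule.Quotient.restrictScalarsEquiv ℤ _).symm (Submodule.Quotient.mk x)) = _
  rw [Submodule.Quotient.restrictScalarsEquiv_symm_mk, Submodule.liftQ_apply, tailFormModPow_apply]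

/-- **The tail pairing of `A_{m,k}`**: `(c', c) ↦ λ_k(c' c) ∈ ℤ/p^k`, bi-additive.
[cite: Howard2004HeegnerKolyvagin, §2.1 (Hom_{S_𝔭}(N, 𝒟_𝔭(1)) ≅ Hom_{ℤ_p}(N, μ_{p^∞})) and §2.2] -/
def EisensteinCoeff.tailPairingZMod {m : ℕ} (hm : 1 ≤ m) (k : ℕ) :
    EisensteinCoeff p m k →+ (EisensteinCoeff p m k →+ ZMod (p ^ k)) :=
  (AddMonoidHom.mul : EisensteinCoeff p m k →+ EisensteinCoeff p m k →+ EisensteinCoeff p m k).compr₂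
    (EisensteinCoeff.tailFormZMod p hm k).toAddMonoidHom

/-- Unfolding: `tailPairing c' c = λ_k(c' c)`. [cite: Howard2004HeegnerKolyvagin, §2.1 and §2.2] -/
@[simp]
theorem EisensteinCoeff.tailPairingZMod_apply_apply {m : ℕ} (hm : 1 ≤ m) (k : ℕ) (c' c : EisensteinCoeff p m k) :
    EisensteinCoeff.tailPairingZMod p hm k c' c = EisensteinCoeff.tailFormZMod p hm k (c' * c) := rfl

/-- The pairing is symmetric. [cite: Howard2004HeegnerKolyvagin, §2.1 and §2.2] -/
theorem EisensteinCoeff.tailPairingZMod_comm {m : ℕ} (hm : 1 ≤ m) (k : ℕ) (c' c : EisensteinCoeff p m k) :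
    EisensteinCoeff.tailPairingZMod p hm k c' c = EisensteinCoeff.tailPairingZMod p hm k c c' := by
  rw [EisensteinCoeff.tailPairingZMod_apply_apply, EisensteinCoeff.tailPairingZMod_apply_apply, mul_comm]

/-- The pairing is `A_{m,k}`-balanced: `(a c', c) = (c', a c)` — `c' ↦ λ_k(c' · )` is `A_{m,k}`-linear for the
action `(a χ)(c) = χ(a c)` on characters. [cite: Howard2004HeegnerKolyvagin, §2.1 («isomorphism of S_𝔭-modules») and §2.2] -/
theorem EisensteinCoeff.tailPairingZMod_mul_left {m : ℕ} (hm : 1 ≤ m) (k : ℕ) (a c' c : EisensteinCoeff p m k) :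
    EisensteinCoeff.tailPairingZMod p hm k (a * c') c = EisensteinCoeff.tailPairingZMod p hm k c' (a * c) := by
  rw [EisensteinCoeff.tailPairingZMod_apply_apply, EisensteinCoeff.tailPairingZMod_apply_apply, mul_comm a c', mul_assoc]

/-- On classes of `Λ`: `tailPairing [x] [y] = λ_S([x][y]) mod p^k`. [cite: Howard2004HeegnerKolyvagin, §2.1 and §2.2] -/
theorem EisensteinCoeff.tailPairingZMod_mk_mk {m : ℕ} (hm : 1 ≤ m) (k : ℕ) (x y : IwasawaAlgebra p) :
    EisensteinCoeff.tailPairingZMod p hm k (Ideal.Quotient.mk _ x) (Ideal.Quotient.mk _ y) =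
      PadicInt.toZModPow k (tailForm (specPowerBasis p hm)
        (Ideal.Quotient.mk _ x * Ideal.Quotient.mk _ y)) := by
  rw [EisensteinCoeff.tailPairingZMod_apply_apply, ← map_mul, EisensteinCoeff.tailFormZMod_mk, map_mul]

/-! ## §3 Pontryagin self-duality of `A_{m,k}` -/

/-- The class in `A_{m,k}` of an element of `p^k · S_m` vanishes (auxiliary). [cite: Howard2004HeegnerKolyvagin, §2.2 (A_𝔮, T_𝔮/p^k T_𝔮)] -/
theorem EisensteinCoeff.mk_eq_zero_of_mk_eq_pow_smul {m : ℕ} (k : ℕ) {x z : IwasawaAlgebra p}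
    (h : (Ideal.Quotient.mk (Ideal.span {(PowerSeries.X ^ m + PowerSeries.C (p : ℤ_[p]) : IwasawaAlgebra p)}) x)
      = ((p : ℤ_[p]) ^ k) • Ideal.Quotient.mk _ z) :
    (Ideal.Quotient.mk _ x : EisensteinCoeff p m k) = 0 := by
  rw [Ideal.Quotient.eq_zero_iff_mem]
  have h1 : x - PowerSeries.C ((p : ℤ_[p]) ^ k) * z ∈
      Ideal.span {(PowerSeries.X ^ m + PowerSeries.C (p : ℤ_[p]) : IwasawaAlgebra p)} := by
    rw [← Ideal.Quotient.eq, h, ← PowerSeries.smul_eq_C_mul]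
    rfl
  have h2 : x = (x - PowerSeries.C ((p : ℤ_[p]) ^ k) * z) + PowerSeries.C ((p : ℤ_[p]) ^ k) * z := by ring
  rw [h2]
  exact Submodule.add_mem_sup h1 (Ideal.mul_mem_right _ _ (Ideal.mem_span_singleton_self _))

/-- **`c' ↦ λ_k(c' · )` is injective**: if `λ_k(c' c) = 0` for all `c ∈ A_{m,k}` then `c' = 0`. Proof: lift
`c' = [x]`; the dual-basis expansion `[x] = ∑ᵢ λ_S([x] π^i) πᵢ^*` in `S_m` (`MonogenicDualizingForm`) has all
coefficients in `ker(ℤ_p → ℤ/p^k) = p^k ℤ_p`, so `[x] ∈ p^k S_m`, i.e. `c' = 0` in `A_{m,k}`.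
[cite: Howard2004HeegnerKolyvagin, §2.1 («whose kernel contains no S_𝔭-submodules») and §2.2] -/
theorem EisensteinCoeff.tailPairingZMod_injective {m : ℕ} (hm : 1 ≤ m) (k : ℕ) :
    Function.Injective (EisensteinCoeff.tailPairingZMod p hm k) := by
  set I : Ideal (IwasawaAlgebra p) :=
    Ideal.span {(PowerSeries.X ^ m + PowerSeries.C (p : ℤ_[p]) : IwasawaAlgebra p)} with hI
  set pb := specPowerBasis p hm with hpb
  refine (injective_iff_map_eq_zero _).mpr fun c' hc' => ?_
  obtain ⟨x, rfl⟩ := Ideal.Quotient.mk_surjective c'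
  -- every coefficient `λ_S([x] * gen^i)` lies in `p^k ℤ_p`
  have hcoef : ∀ i : Fin pb.dim, ∃ u : ℤ_[p],
      tailForm pb (Ideal.Quotient.mk I x * pb.gen ^ (i : ℕ)) = ((p : ℤ_[p]) ^ k) * u := by
    intro i
    obtain ⟨y, hy⟩ := Ideal.Quotient.mk_surjective (pb.gen ^ (i : ℕ))
    have h0 : EisensteinCoeff.tailPairingZMod p hm k (Ideal.Quotient.mk _ x) (Ideal.Quotient.mk _ y) = 0 := by
      rw [hc', AddMonoidHom.zero_apply]
    rw [EisensteinCoeff.tailPairingZMod_mk_mk, ← RingHom.mem_ker, PadicInt.ker_toZModPow,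
      Ideal.mem_span_singleton'] at h0
    obtain ⟨u, hu⟩ := h0
    exact ⟨u, by rw [← hy, ← hu, mul_comm]⟩
  choose u hu using hcoef
  -- hence `[x] = p^k • z₀` in `S_m`
  have hx : Ideal.Quotient.mk I x = ((p : ℤ_[p]) ^ k) • ∑ i : Fin pb.dim, u i • tailDualBasis pb i := by
    conv_lhs => rw [← sum_tailForm_mul_pow_smul_tailDualBasis pb (Ideal.Quotient.mk I x)]
    rw [Finset.smul_sum]
    refine Finset.sum_congr rfl fun i _ => ?_
    rw [hu i, mul_smul]
  obtain ⟨z, hz⟩ := Ideal.Quotient.mk_surjective (∑ i : Fin pb.dim, u i • tailDualBasis pb i)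
  rw [← hz] at hx
  exact EisensteinCoeff.mk_eq_zero_of_mk_eq_pow_smul p k hx

/-- `p^k` kills `A_{m,k}` as a `ℤ_p`-scalar. [cite: Howard2004HeegnerKolyvagin, §2.2 (A_𝔮, T_𝔮/p^k T_𝔮)] -/
theorem EisensteinCoeff.padicInt_pow_smul_eq_zero {m : ℕ} (k : ℕ) (a : EisensteinCoeff p m k) :
    ((p : ℤ_[p]) ^ k) • a = 0 := by
  obtain ⟨y, rfl⟩ := Ideal.Quotient.mk_surjective a
  change (Ideal.Quotient.mk _ (((p : ℤ_[p]) ^ k) • y) : EisensteinCoeff p m k) = 0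
  rw [PowerSeries.smul_eq_C_mul, Ideal.Quotient.eq_zero_iff_mem]
  exact Ideal.mem_sup_right (Ideal.mul_mem_right _ _ (Ideal.mem_span_singleton_self _))

/-- **Additive characters of `A_{m,k}` are `ℤ_p`-semilinear**: `χ(c • a) = (c mod p^k) · χ(a)` for every additive
`χ : A_{m,k} → ℤ/p^k`, `c ∈ ℤ_p` (write `c = appr_k(c) + p^k d`, Mathlib `PadicInt.appr_spec`).
[cite: Washington1997, §13.2] [cite: Howard2004HeegnerKolyvagin, §2.2] -/
theorem EisensteinCoeff.addMonoidHom_map_smul {m : ℕ} (k : ℕ) (χ : EisensteinCoeff p m k →+ ZMod (p ^ k))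
    (c : ℤ_[p]) (a : EisensteinCoeff p m k) : χ (c • a) = PadicInt.toZModPow k c * χ a := by
  obtain ⟨d, hd⟩ := Ideal.mem_span_singleton'.mp (PadicInt.appr_spec k c)
  have hc : c = ((c.appr k : ℕ) : ℤ_[p]) + d * (p : ℤ_[p]) ^ k := by rw [hd]; ring
  have htz : PadicInt.toZModPow k c = ((c.appr k : ℕ) : ZMod (p ^ k)) := rfl
  have h1 : c • a = (c.appr k) • a := by
    conv_lhs => rw [hc]
    rw [add_smul, mul_smul, EisensteinCoeff.padicInt_pow_smul_eq_zero p k a, smul_zero, add_zero,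
      Nat.cast_smul_eq_nsmul]
  rw [h1, map_nsmul, nsmul_eq_mul, htz]

/-- **Every element of `A_{m,k}` is a `ℤ_p`-combination of the classes `[T^i]`, `i < m`** (coordinates in the
power basis of `S_m`). [cite: Washington1997, §7.1 (Prop. 7.2) and §13.2] [cite: Howard2004HeegnerKolyvagin, §2.2] -/
theorem EisensteinCoeff.exists_eq_sum_padicInt_smul_mk_X_pow {m : ℕ} (hm : 1 ≤ m) (k : ℕ) (a : EisensteinCoeff p m k) :
    ∃ c : Fin m → ℤ_[p], a = ∑ i : Fin m, c i • (Ideal.Quotient.mk _ ((PowerSeries.X : IwasawaAlgebra p) ^ (i : ℕ)) :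
      EisensteinCoeff p m k) := by
  set I : Ideal (IwasawaAlgebra p) :=
    Ideal.span {(PowerSeries.X ^ m + PowerSeries.C (p : ℤ_[p]) : IwasawaAlgebra p)} with hI
  obtain ⟨x, rfl⟩ := Ideal.Quotient.mk_surjective a
  have hdim : (specPowerBasis p hm).dim = m := specPowerBasis_dim p hm
  -- coordinates of `[x]` in the power basis of `S_m`
  let c : Fin m → ℤ_[p] := fun j => (specPowerBasis p hm).basis.repr (Ideal.Quotient.mk I x) (Fin.cast hdim.symm j)
  refine ⟨c, ?_⟩
  have hS : Ideal.Quotient.mk I x =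
      ∑ j : Fin m, c j • Ideal.Quotient.mk I ((PowerSeries.X : IwasawaAlgebra p) ^ (j : ℕ)) := by
    have h := ((specPowerBasis p hm).basis.sum_repr (Ideal.Quotient.mk I x)).symm
    rw [← (Fin.castOrderIso hdim.symm).toEquiv.sum_comp] at h
    refine h.trans (Finset.sum_congr rfl fun j _ => ?_)
    simp only [RelIso.coe_fn_toEquiv, Fin.castOrderIso_apply, PowerBasis.basis_eq_pow, specPowerBasis_gen,
      Fin.val_cast, map_pow, c]
    rfl
  -- push through `S_m → A_{m,k}`: `x - ∑ c_j X^j ∈ I ≤ (I, p^k)`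
  have hS' : x - ∑ j : Fin m, c j • (PowerSeries.X : IwasawaAlgebra p) ^ (j : ℕ) ∈ I := by
    rw [← Ideal.Quotient.eq, hS, map_sum]
    rfl
  have hA : (Ideal.Quotient.mk _ x : EisensteinCoeff p m k) =
      Ideal.Quotient.mk _ (∑ j : Fin m, c j • (PowerSeries.X : IwasawaAlgebra p) ^ (j : ℕ)) := by
    rw [Ideal.Quotient.eq]
    exact Ideal.mem_sup_left hS'
  rw [hA, map_sum]
  rfl

/-- **`#Hom(A_{m,k}, ℤ/p^k) ≤ p^{km}`**: an additive character of `A_{m,k}` is determined by its values on the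
classes `[T^i]`, `i < m` (`ℤ_p`-generation + semilinearity). [cite: Washington1997, §13.2] [cite: Howard2004HeegnerKolyvagin, §2.2] -/
theorem EisensteinCoeff.natCard_addMonoidHom_zmod_le {m : ℕ} (hm : 1 ≤ m) (k : ℕ) :
    Finite (EisensteinCoeff p m k →+ ZMod (p ^ k)) ∧
      Nat.card (EisensteinCoeff p m k →+ ZMod (p ^ k)) ≤ p ^ (k * m) := by
  let ev : (EisensteinCoeff p m k →+ ZMod (p ^ k)) → (Fin m → ZMod (p ^ k)) :=
    fun χ i => χ (Ideal.Quotient.mk _ ((PowerSeries.X : IwasawaAlgebra p) ^ (i : ℕ)))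
  have hev : Function.Injective ev := by
    intro χ χ' h
    ext a
    obtain ⟨c, rfl⟩ := EisensteinCoeff.exists_eq_sum_padicInt_smul_mk_X_pow p hm k a
    rw [map_sum, map_sum]
    refine Finset.sum_congr rfl fun i _ => ?_
    rw [EisensteinCoeff.addMonoidHom_map_smul, EisensteinCoeff.addMonoidHom_map_smul]
    exact congrArg _ (congr_fun h i)
  haveI : Finite (EisensteinCoeff p m k →+ ZMod (p ^ k)) := Finite.of_injective ev hev
  refine ⟨inferInstance, ?_⟩
  calc Nat.card (EisensteinCoeff p m k →+ ZMod (p ^ k))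
      ≤ Nat.card (Fin m → ZMod (p ^ k)) := Nat.card_le_card_of_injective ev hev
    _ = p ^ (k * m) := by
        rw [Nat.card_pi, Finset.prod_const, Nat.card_zmod, Finset.card_univ, Fintype.card_fin, pow_mul]

/-- **Pontryagin self-duality of `A_{m,k}`**: `c' ↦ λ_k(c' · )` is a bijection `A_{m,k} → Hom(A_{m,k}, ℤ/p^k)`
(injective by `tailPairingZMod_injective`; both sides have at most / exactly `p^{km}` elements). Equivalently
`Hom_ℤ(A_{m,k}, ℚ/ℤ) ≅ A_{m,k}` as `A_{m,k}`-modules (`tailPairing_mul_left`) — the finite-level form of Howard's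
`Hom_{S_𝔭}(N, 𝒟_𝔭(1)) ≅ Hom_{ℤ_p}(N, μ_{p^∞})` at `N = A_𝔮[p^k]`. [cite: Howard2004HeegnerKolyvagin, §2.1 and §2.2 (proof of Thm. 2.2.10, 𝔮 = T^m + p)] -/
theorem EisensteinCoeff.tailPairingZMod_bijective {m : ℕ} (hm : 1 ≤ m) (k : ℕ) :
    Function.Bijective (EisensteinCoeff.tailPairingZMod p hm k) := by
  obtain ⟨hfin, hcard⟩ := EisensteinCoeff.natCard_addMonoidHom_zmod_le p hm k
  haveI := hfin
  haveI : Finite (EisensteinCoeff p m k) := finite_quotient_span_qm_sup_span_C_pow p hm k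
  refine (EisensteinCoeff.tailPairingZMod_injective p hm k).bijective_of_nat_card_le ?_
  rw [card_quotient_span_qm_sup_span_C_pow p hm k]
  exact hcard

/-- **`A_{m,k} ≃+ Hom(A_{m,k}, ℤ/p^k)`, `c' ↦ λ_k(c' · )`.** [cite: Howard2004HeegnerKolyvagin, §2.1 and §2.2 (proof of Thm. 2.2.10, 𝔮 = T^m + p)] -/
def EisensteinCoeff.tailPairingZModEquiv {m : ℕ} (hm : 1 ≤ m) (k : ℕ) :
    EisensteinCoeff p m k ≃+ (EisensteinCoeff p m k →+ ZMod (p ^ k)) :=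
  AddEquiv.ofBijective (EisensteinCoeff.tailPairingZMod p hm k) (EisensteinCoeff.tailPairingZMod_bijective p hm k)

/-- Unfolding: `tailPairingEquiv c' = λ_k(c' · )`. [cite: Howard2004HeegnerKolyvagin, §2.1 and §2.2] -/
@[simp]
theorem EisensteinCoeff.tailPairingZModEquiv_apply {m : ℕ} (hm : 1 ≤ m) (k : ℕ) (c' : EisensteinCoeff p m k) :
    EisensteinCoeff.tailPairingZModEquiv p hm k c' = EisensteinCoeff.tailPairingZMod p hm k c' := rfl

/-- **Every character `χ : A_{m,k} → ℤ/p^k` is `λ_k(c' · )` for a unique `c' ∈ A_{m,k}`.**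
[cite: Howard2004HeegnerKolyvagin, §2.1 and §2.2 (proof of Thm. 2.2.10, 𝔮 = T^m + p)] -/
theorem EisensteinCoeff.existsUnique_eq_tailFormZMod_mul {m : ℕ} (hm : 1 ≤ m) (k : ℕ)
    (χ : EisensteinCoeff p m k →+ ZMod (p ^ k)) :
    ∃! c' : EisensteinCoeff p m k, ∀ c, χ c = EisensteinCoeff.tailFormZMod p hm k (c' * c) := by
  obtain ⟨c', hc'⟩ := (EisensteinCoeff.tailPairingZMod_bijective p hm k).2 χ
  refine ⟨c', fun c => by rw [← hc', EisensteinCoeff.tailPairingZMod_apply_apply], fun c'' hc'' => ?_⟩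
  refine (EisensteinCoeff.tailPairingZMod_bijective p hm k).1 (hc'.symm ▸ ?_)
  ext c
  rw [EisensteinCoeff.tailPairingZMod_apply_apply, ← hc'' c]

/-- Non-degeneracy of `λ_k`: `λ_k(c' c) = 0` for all `c` forces `c' = 0` — the kernel of `λ_k` contains no
non-zero ideal of `A_{m,k}`. [cite: Howard2004HeegnerKolyvagin, §2.1 («whose kernel contains no S_𝔭-submodules») and §2.2] -/
theorem EisensteinCoeff.eq_zero_of_forall_tailFormZMod_mul_eq_zero {m : ℕ} (hm : 1 ≤ m) (k : ℕ)
    {c' : EisensteinCoeff p m k} (h : ∀ c, EisensteinCoeff.tailFormZMod p hm k (c' * c) = 0) : c' = 0 := by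
  refine (injective_iff_map_eq_zero _).mp (EisensteinCoeff.tailPairingZMod_injective p hm k) c' ?_
  ext c
  rw [EisensteinCoeff.tailPairingZMod_apply_apply, h, AddMonoidHom.zero_apply]

end Literature.NumberTheory.EllipticCurves.IwasawaAlgebra
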